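import Summits.AtomisticToContinuum.Crystallization.Theorems.OverbindingBudgetAffineFarStraighteningCaps

/-!
# Overbinding budget, affine far field — DEVELOPMENT, pattern certificates (lens-4 g59, brick D-A)

Two finite facts about the FCC / HCP two-shell patterns `P` (with `0` adjoined) needed by the radial development `RaffDevelopment`
(memo NODE-g59-DevSpec §3 L2, L4), each proved by `decide` on the integer models and transported to `EuclideanSpace ℝ (Fin 3)`:

* **pattern gap** (`norm_sub_eq_one_or_sqrt_two_le_of_twoShell`): two distinct points of `insert 0 P` are at distance exactly `1` or at
  distance `≥ √2` — so "pattern-adjacent" is read off a physical distance `≤ 1.22·nn` with room;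
* **tripod** (`exists_tripod_of_twoShell`): for adjacent first-shell `f₁, f₂ ∈ P` some first-shell `g ∈ P` lies within two shells of both
  (`dist ∈ {1, √2}`) and OFF their span, packaged as the extension property "two linear maps agreeing on `f₁, f₂, g` are equal"
  (Cramer's identity `cramer3`, no `Basis` machinery);
* **half-frame** (`linearMap_eq_of_halfFrame`): for unit `f ∈ P` and a good pair `c₁, c₂` of its common shell (the frame on which the
  development DEFINES the exact relabelling, cf. `snapRigidity_pair`), linear maps are determined by their values on `f, c₁, c₂`.
-/

namespace Summit.AtomisticToContinuum.Crystallization.Theorems.OverbindingBudgetAffineFarSmoothSplit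

open scoped BigOperators RealInnerProductSpace
open Literature.Geometry.DiscreteGeometry (fccTwoShellPattern hcpTwoShellPattern scaledPattern intVec intVec_apply intVec_sub norm_intVec
  sqNormInt fccInt hcpInt fccSecondShellInt hcpSecondShellInt sqNormInt_fccInt sqNormInt_hcpInt)

/-! ## §1  Integer certificates (PROVED, `decide`) -/

/-- Pattern gap on the integer model: distinct points of `insert 0 S` differ by a vector of squared norm `N` or `≥ 2N`. [this file] -/
def PatternGapInt (S : Finset (Fin 3 → ℤ)) (N : ℤ) : Prop :=
  ∀ a ∈ insert (0 : Fin 3 → ℤ) S, ∀ b ∈ insert (0 : Fin 3 → ℤ) S, a ≠ b → sqNormInt (a - b) = N ∨ 2 * N ≤ sqNormInt (a - b)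

/-- FCC two-shell model: difference squared norms lie in `{2} ∪ [4, ∞)`. [this file] -/
theorem patternGapInt_fcc : PatternGapInt (fccInt ∪ fccSecondShellInt) 2 := by
  unfold PatternGapInt; decide

/-- HCP two-shell model: difference squared norms lie in `{18} ∪ [36, ∞)` (they are `18, 36, 48, 54, 66, 72, …`). [this file] -/
theorem patternGapInt_hcp : PatternGapInt (hcpInt ∪ hcpSecondShellInt) 18 := by
  unfold PatternGapInt; decide

/-- The `3 × 3` determinant of three integer vectors. [folklore] -/
def det3 (a b c : Fin 3 → ℤ) : ℤ :=
  a 0 * (b 1 * c 2 - b 2 * c 1) - a 1 * (b 0 * c 2 - b 2 * c 0) + a 2 * (b 0 * c 1 - b 1 * c 0)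

/-- Tripod property on the integer model: for adjacent first-shell `f₁, f₂` (both in `S₁`, `|f₁ − f₂|² = N`) some first-shell `g` has
`|g − f₁|², |g − f₂|² ∈ {N, 2N}` and `det(f₁, f₂, g) ≠ 0`. [this file] -/
def TripodInt (S₁ : Finset (Fin 3 → ℤ)) (N : ℤ) : Prop :=
  ∀ f₁ ∈ S₁, ∀ f₂ ∈ S₁, sqNormInt (f₁ - f₂) = N →
    ∃ g ∈ S₁, (sqNormInt (g - f₁) = N ∨ sqNormInt (g - f₁) = 2 * N) ∧ (sqNormInt (g - f₂) = N ∨ sqNormInt (g - f₂) = 2 * N) ∧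
      det3 f₁ f₂ g ≠ 0

/-- FCC: the tetrahedral cap over an adjacent pair. [this file] -/
theorem tripodInt_fcc : TripodInt fccInt 2 := by
  unfold TripodInt; decide

/-- HCP: over a basal down-triangle the site above the neighbouring up-triangle is at distances `(1, √2)`. [this file] -/
theorem tripodInt_hcp : TripodInt hcpInt 18 := by
  unfold TripodInt; decide

/-- Half-frame property on the integer model: for first-shell `f, c₁, c₂` with `c₁, c₂` adjacent to `f` and `|c₁ − c₂|² ∈ {N, 2N}` (a good pair
of the common shell of `f`), `det(f, c₁, c₂) ≠ 0`. [this file] -/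
def HalfFrameDetInt (S₁ : Finset (Fin 3 → ℤ)) (N : ℤ) : Prop :=
  ∀ f ∈ S₁, ∀ c₁ ∈ S₁, ∀ c₂ ∈ S₁, sqNormInt (c₁ - f) = N → sqNormInt (c₂ - f) = N →
    (sqNormInt (c₁ - c₂) = N ∨ sqNormInt (c₁ - c₂) = 2 * N) → det3 f c₁ c₂ ≠ 0

/-- FCC half-frames are non-degenerate. [this file] -/
theorem halfFrameDetInt_fcc : HalfFrameDetInt fccInt 2 := by
  unfold HalfFrameDetInt; decide

/-- HCP half-frames are non-degenerate. [this file] -/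
theorem halfFrameDetInt_hcp : HalfFrameDetInt hcpInt 18 := by
  unfold HalfFrameDetInt; decide

/-! ## §2  Cramer's identity and the extension property (PROVED) -/

/-- The `3 × 3` determinant of three vectors of `E³`, in coordinates. [folklore] -/
noncomputable def det3R (a b c : EuclideanSpace ℝ (Fin 3)) : ℝ :=
  a 0 * (b 1 * c 2 - b 2 * c 1) - a 1 * (b 0 * c 2 - b 2 * c 0) + a 2 * (b 0 * c 1 - b 1 * c 0)

/-- Cramer's identity: `det(a,b,c)·v = det(v,b,c)·a + det(a,v,c)·b + det(a,b,v)·c`. [folklore] -/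
theorem cramer3 (a b c v : EuclideanSpace ℝ (Fin 3)) :
    det3R a b c • v = det3R v b c • a + det3R a v c • b + det3R a b v • c := by
  ext i
  fin_cases i <;> simp [det3R] <;> ring

/-- The determinant of integer vectors is the integer determinant. [folklore] -/
theorem det3R_intVec (a b c : Fin 3 → ℤ) : det3R (intVec a) (intVec b) (intVec c) = (det3 a b c : ℝ) := by
  simp [det3R, det3, intVec_apply]

/-- Scaling all three vectors scales the determinant by the cube. [folklore] -/
theorem det3R_smul (s : ℝ) (a b c : EuclideanSpace ℝ (Fin 3)) : det3R (s • a) (s • b) (s • c) = s ^ 3 * det3R a b c := by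
  simp [det3R]
  ring

/-- **Extension property**: two linear maps that agree on three vectors with non-zero determinant are equal. [folklore] -/
theorem linearMap_eq_of_det3R_ne_zero {a b c : EuclideanSpace ℝ (Fin 3)} (hdet : det3R a b c ≠ 0)
    {L₁ L₂ : EuclideanSpace ℝ (Fin 3) →ₗ[ℝ] EuclideanSpace ℝ (Fin 3)} (ha : L₁ a = L₂ a) (hb : L₁ b = L₂ b) (hc : L₁ c = L₂ c) :
    L₁ = L₂ := by
  ext v : 1
  have h := cramer3 a b c v
  have h1 : det3R a b c • L₁ v = det3R a b c • L₂ v := by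
    rw [← map_smul, ← map_smul, h]
    simp only [map_add, map_smul, ha, hb, hc]
  exact smul_right_injective _ hdet h1

/-! ## §3  The two facts on the real two-shell patterns (PROVED) -/

/-- Pattern gap, generic scaled form. [this file] -/
theorem norm_sub_eq_one_or_sqrt_two_le_scaled {S : Finset (Fin 3 → ℤ)} {N : ℕ} (hN : N ≠ 0) (hgap : PatternGapInt S N)
    {u u' : EuclideanSpace ℝ (Fin 3)} (hu : u ∈ insert (0 : EuclideanSpace ℝ (Fin 3)) (scaledPattern S N))
    (hu' : u' ∈ insert (0 : EuclideanSpace ℝ (Fin 3)) (scaledPattern S N)) (hne : u ≠ u') :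
    ‖u - u'‖ = 1 ∨ Real.sqrt 2 ≤ ‖u - u'‖ := by
  have hpos : (0 : ℝ) < Real.sqrt N := by positivity
  -- both points are scaled integer vectors of `insert 0 S`
  have hrep : ∀ w ∈ insert (0 : EuclideanSpace ℝ (Fin 3)) (scaledPattern S N), ∃ z ∈ insert (0 : Fin 3 → ℤ) S,
      w = (Real.sqrt N)⁻¹ • intVec z := by
    intro w hw
    rcases Finset.mem_insert.1 hw with rfl | hw
    · exact ⟨0, Finset.mem_insert_self _ _, by ext i; simp⟩
    · obtain ⟨z, hz, rfl⟩ := Finset.mem_image.1 hw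
      exact ⟨z, Finset.mem_insert_of_mem hz, rfl⟩
  obtain ⟨a, ha, rfl⟩ := hrep u hu
  obtain ⟨b, hb, rfl⟩ := hrep u' hu'
  have hab : a ≠ b := fun h => hne (by rw [h])
  rw [← dist_eq_norm, dist_scaled_intVec]
  rcases hgap a ha b hb hab with h | h
  · left
    rw [h, Int.cast_natCast, inv_mul_cancel₀ hpos.ne']
  · right
    have hcast : (2 * N : ℝ) ≤ (sqNormInt (a - b) : ℝ) := by exact_mod_cast h
    rw [le_inv_mul_iff₀ hpos, ← Real.sqrt_mul (Nat.cast_nonneg _)]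
    exact Real.sqrt_le_sqrt (by linarith)

/-- **PATTERN GAP**: two distinct points of `insert 0 P` (P a two-shell pattern) are at distance `1` or at distance `≥ √2`. [this file] -/
theorem norm_sub_eq_one_or_sqrt_two_le_of_twoShell {P : Finset (EuclideanSpace ℝ (Fin 3))}
    (hP : P = fccTwoShellPattern ∨ P = hcpTwoShellPattern) {u u' : EuclideanSpace ℝ (Fin 3)}
    (hu : u ∈ insert (0 : EuclideanSpace ℝ (Fin 3)) P) (hu' : u' ∈ insert (0 : EuclideanSpace ℝ (Fin 3)) P) (hne : u ≠ u') :
    ‖u - u'‖ = 1 ∨ Real.sqrt 2 ≤ ‖u - u'‖ := by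
  rcases hP with rfl | rfl
  · exact norm_sub_eq_one_or_sqrt_two_le_scaled two_ne_zero patternGapInt_fcc hu hu' hne
  · exact norm_sub_eq_one_or_sqrt_two_le_scaled (by norm_num) patternGapInt_hcp hu hu' hne

/-- Tripod, generic scaled form. [this file] -/
theorem exists_tripod_scaled {S S₂ : Finset (Fin 3 → ℤ)} {N : ℕ} (hN : N ≠ 0)
    (hSnorm : ∀ z ∈ S, sqNormInt z = N) (hfirst : ∀ z ∈ S ∪ S₂, sqNormInt z = N → z ∈ S) (htri : TripodInt S N)
    {f₁ f₂ : EuclideanSpace ℝ (Fin 3)} (hf₁ : f₁ ∈ scaledPattern (S ∪ S₂) N) (h₁ : ‖f₁‖ = 1)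
    (hf₂ : f₂ ∈ scaledPattern (S ∪ S₂) N) (h₂ : ‖f₂‖ = 1) (h12 : dist f₁ f₂ = 1) :
    ∃ g ∈ scaledPattern (S ∪ S₂) N, ‖g‖ = 1 ∧ (dist g f₁ = 1 ∨ dist g f₁ = Real.sqrt 2) ∧ (dist g f₂ = 1 ∨ dist g f₂ = Real.sqrt 2) ∧
      det3R f₁ f₂ g ≠ 0 := by
  have hpos : (0 : ℝ) < Real.sqrt N := by positivity
  obtain ⟨z₁, hz₁, rfl⟩ := Finset.mem_image.1 hf₁
  obtain ⟨z₂, hz₂, rfl⟩ := Finset.mem_image.1 hf₂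
  have hz₁S : z₁ ∈ S := hfirst z₁ hz₁ (sqNormInt_eq_of_norm_scaled_eq_one hN h₁)
  have hz₂S : z₂ ∈ S := hfirst z₂ hz₂ (sqNormInt_eq_of_norm_scaled_eq_one hN h₂)
  have hd12 : sqNormInt (z₁ - z₂) = N := by
    rw [dist_scaled_intVec, inv_mul_eq_iff_eq_mul₀ hpos.ne', mul_one] at h12
    have h2 : (sqNormInt (z₁ - z₂) : ℝ) = (N : ℝ) := by
      have := congrArg (fun x => x ^ 2) h12
      simpa [Real.sq_sqrt (show (0 : ℝ) ≤ (sqNormInt (z₁ - z₂) : ℝ) by unfold sqNormInt; push_cast; positivity),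
        Real.sq_sqrt (Nat.cast_nonneg N)] using this
    exact_mod_cast h2
  obtain ⟨g, hgS, hg1, hg2, hdet⟩ := htri z₁ hz₁S z₂ hz₂S hd12
  have hmem : (Real.sqrt N)⁻¹ • intVec g ∈ scaledPattern (S ∪ S₂) N := Finset.mem_image_of_mem _ (Finset.mem_union_left _ hgS)
  -- distances `1` or `√2` from the two alternatives `N`, `2N`
  have hdist : ∀ z : Fin 3 → ℤ, (sqNormInt (g - z) = N ∨ sqNormInt (g - z) = 2 * N) →
      dist ((Real.sqrt N)⁻¹ • intVec g) ((Real.sqrt N)⁻¹ • intVec z) = 1 ∨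
        dist ((Real.sqrt N)⁻¹ • intVec g) ((Real.sqrt N)⁻¹ • intVec z) = Real.sqrt 2 := by
    intro z hz
    rw [dist_scaled_intVec]
    rcases hz with h | h
    · left; rw [h, Int.cast_natCast, inv_mul_cancel₀ hpos.ne']
    · right
      rw [h]; push_cast
      rw [Real.sqrt_mul (by norm_num : (0 : ℝ) ≤ 2), mul_comm (Real.sqrt 2), ← mul_assoc, inv_mul_cancel₀ hpos.ne', one_mul]
  refine ⟨_, hmem, norm_scaled_eq_one hN (hSnorm g hgS), hdist z₁ hg1, hdist z₂ hg2, ?_⟩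
  rw [det3R_smul, det3R_intVec]
  have hdet' : (det3 z₁ z₂ g : ℝ) ≠ 0 := by exact_mod_cast hdet
  exact mul_ne_zero (pow_ne_zero 3 (inv_ne_zero hpos.ne')) hdet'

/-- **TRIPOD** for the two-shell patterns: for adjacent first-shell `f₁, f₂ ∈ P` there is a first-shell `g ∈ P` within two shells of
both (`dist ∈ {1, √2}`) such that linear maps are determined by their values on `f₁, f₂, g`. [this file] -/
theorem exists_tripod_of_twoShell {P : Finset (EuclideanSpace ℝ (Fin 3))} (hP : P = fccTwoShellPattern ∨ P = hcpTwoShellPattern)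
    {f₁ f₂ : EuclideanSpace ℝ (Fin 3)} (hf₁ : f₁ ∈ P) (h₁ : ‖f₁‖ = 1) (hf₂ : f₂ ∈ P) (h₂ : ‖f₂‖ = 1) (h12 : dist f₁ f₂ = 1) :
    ∃ g ∈ P, ‖g‖ = 1 ∧ (dist g f₁ = 1 ∨ dist g f₁ = Real.sqrt 2) ∧ (dist g f₂ = 1 ∨ dist g f₂ = Real.sqrt 2) ∧
      ∀ L₁ L₂ : EuclideanSpace ℝ (Fin 3) →ₗ[ℝ] EuclideanSpace ℝ (Fin 3),
        L₁ f₁ = L₂ f₁ → L₁ f₂ = L₂ f₂ → L₁ g = L₂ g → L₁ = L₂ := by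
  have key : ∃ g ∈ P, ‖g‖ = 1 ∧ (dist g f₁ = 1 ∨ dist g f₁ = Real.sqrt 2) ∧ (dist g f₂ = 1 ∨ dist g f₂ = Real.sqrt 2) ∧
      det3R f₁ f₂ g ≠ 0 := by
    rcases hP with rfl | rfl
    · have hS : ∀ z ∈ fccInt, sqNormInt z = ((2 : ℕ) : ℤ) := sqNormInt_fccInt
      exact exists_tripod_scaled two_ne_zero hS mem_fccInt_of_sqNormInt tripodInt_fcc hf₁ h₁ hf₂ h₂ h12
    · have hS : ∀ z ∈ hcpInt, sqNormInt z = ((18 : ℕ) : ℤ) := sqNormInt_hcpInt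
      exact exists_tripod_scaled (by norm_num) hS mem_hcpInt_of_sqNormInt tripodInt_hcp hf₁ h₁ hf₂ h₂ h12
  obtain ⟨g, hg, hg1, hd1, hd2, hdet⟩ := key
  exact ⟨g, hg, hg1, hd1, hd2, fun L₁ L₂ ha hb hc => linearMap_eq_of_det3R_ne_zero hdet ha hb hc⟩

/-- Squared distance `q` between scaled integer vectors means `|a − b|² = q·N`. [folklore] -/
theorem sqNormInt_sub_eq_of_dist_sq {N : ℕ} (hN : N ≠ 0) (a b : Fin 3 → ℤ) {q : ℕ}
    (h : dist ((Real.sqrt N)⁻¹ • intVec a) ((Real.sqrt N)⁻¹ • intVec b) ^ 2 = q) : sqNormInt (a - b) = q * N := by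
  have hX0 : (0 : ℝ) ≤ (sqNormInt (a - b) : ℝ) := by unfold sqNormInt; push_cast; positivity
  rw [dist_scaled_intVec, mul_pow, inv_pow, Real.sq_sqrt (Nat.cast_nonneg _), Real.sq_sqrt hX0,
    inv_mul_eq_iff_eq_mul₀ (by exact_mod_cast hN : (N : ℝ) ≠ 0)] at h
  have h' : (sqNormInt (a - b) : ℝ) = ((q * N : ℕ) : ℝ) := by rw [h]; push_cast; ring
  exact_mod_cast h'

/-- Half-frame non-degeneracy, generic scaled form. [this file] -/
theorem det3R_ne_zero_of_halfFrame_scaled {S S₂ : Finset (Fin 3 → ℤ)} {N : ℕ} (hN : N ≠ 0)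
    (hfirst : ∀ z ∈ S ∪ S₂, sqNormInt z = N → z ∈ S) (hhf : HalfFrameDetInt S N)
    {f c₁ c₂ : EuclideanSpace ℝ (Fin 3)} (hf : f ∈ scaledPattern (S ∪ S₂) N) (hf1 : ‖f‖ = 1)
    (hc₁ : c₁ ∈ scaledPattern (S ∪ S₂) N) (hc₁1 : ‖c₁‖ = 1) (hc₁f : ‖c₁ - f‖ = 1)
    (hc₂ : c₂ ∈ scaledPattern (S ∪ S₂) N) (hc₂1 : ‖c₂‖ = 1) (hc₂f : ‖c₂ - f‖ = 1) (hpair : ⟪c₁, c₂⟫ = 1 / 2 ∨ ⟪c₁, c₂⟫ = 0) :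
    det3R f c₁ c₂ ≠ 0 := by
  have hpos : (0 : ℝ) < Real.sqrt N := by positivity
  have h12sq : ‖c₁ - c₂‖ ^ 2 = 2 - 2 * ⟪c₁, c₂⟫ := by rw [norm_sub_sq_real, hc₁1, hc₂1]; ring
  obtain ⟨zf, hzf, rfl⟩ := Finset.mem_image.1 hf
  obtain ⟨z₁, hz₁, rfl⟩ := Finset.mem_image.1 hc₁
  obtain ⟨z₂, hz₂, rfl⟩ := Finset.mem_image.1 hc₂
  have hzfS : zf ∈ S := hfirst zf hzf (sqNormInt_eq_of_norm_scaled_eq_one hN hf1)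
  have hz₁S : z₁ ∈ S := hfirst z₁ hz₁ (sqNormInt_eq_of_norm_scaled_eq_one hN hc₁1)
  have hz₂S : z₂ ∈ S := hfirst z₂ hz₂ (sqNormInt_eq_of_norm_scaled_eq_one hN hc₂1)
  have h1f : sqNormInt (z₁ - zf) = N := by
    have := sqNormInt_sub_eq_of_dist_sq hN z₁ zf (q := 1) (by rw [dist_eq_norm, hc₁f]; norm_num)
    simpa using this
  have h2f : sqNormInt (z₂ - zf) = N := by
    have := sqNormInt_sub_eq_of_dist_sq hN z₂ zf (q := 1) (by rw [dist_eq_norm, hc₂f]; norm_num)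
    simpa using this
  have h12 : sqNormInt (z₁ - z₂) = N ∨ sqNormInt (z₁ - z₂) = 2 * N := by
    rcases hpair with hp | hp
    · left
      have := sqNormInt_sub_eq_of_dist_sq hN z₁ z₂ (q := 1) (by rw [dist_eq_norm, h12sq, hp]; norm_num)
      simpa using this
    · right
      have := sqNormInt_sub_eq_of_dist_sq hN z₁ z₂ (q := 2) (by rw [dist_eq_norm, h12sq, hp]; norm_num)
      simpa using this
  have hdet := hhf zf hzfS z₁ hz₁S z₂ hz₂S h1f h2f h12
  rw [det3R_smul, det3R_intVec]
  have hdet' : (det3 zf z₁ z₂ : ℝ) ≠ 0 := by exact_mod_cast hdet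
  exact mul_ne_zero (pow_ne_zero 3 (inv_ne_zero hpos.ne')) hdet'

/-- **HALF-FRAME EXTENSION**: for a two-shell pattern `P`, unit `f ∈ P` and a good pair `c₁, c₂` of the common shell of `f` (unit, adjacent to
`f`, `⟪c₁,c₂⟫ ∈ {1/2, 0}`), two linear maps agreeing on `f, c₁, c₂` are equal. [this file] -/
theorem linearMap_eq_of_halfFrame {P : Finset (EuclideanSpace ℝ (Fin 3))} (hP : P = fccTwoShellPattern ∨ P = hcpTwoShellPattern)
    {f c₁ c₂ : EuclideanSpace ℝ (Fin 3)} (hf : f ∈ P) (hf1 : ‖f‖ = 1) (hc₁ : c₁ ∈ P) (hc₁1 : ‖c₁‖ = 1) (hc₁f : ‖c₁ - f‖ = 1)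
    (hc₂ : c₂ ∈ P) (hc₂1 : ‖c₂‖ = 1) (hc₂f : ‖c₂ - f‖ = 1) (hpair : ⟪c₁, c₂⟫ = 1 / 2 ∨ ⟪c₁, c₂⟫ = 0)
    {L₁ L₂ : EuclideanSpace ℝ (Fin 3) →ₗ[ℝ] EuclideanSpace ℝ (Fin 3)} (h0 : L₁ f = L₂ f) (h1 : L₁ c₁ = L₂ c₁) (h2 : L₁ c₂ = L₂ c₂) :
    L₁ = L₂ := by
  have hdet : det3R f c₁ c₂ ≠ 0 := by
    rcases hP with rfl | rfl
    · exact det3R_ne_zero_of_halfFrame_scaled two_ne_zero mem_fccInt_of_sqNormInt halfFrameDetInt_fcc hf hf1 hc₁ hc₁1 hc₁f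
        hc₂ hc₂1 hc₂f hpair
    · exact det3R_ne_zero_of_halfFrame_scaled (by norm_num) mem_hcpInt_of_sqNormInt halfFrameDetInt_hcp hf hf1 hc₁ hc₁1 hc₁f
        hc₂ hc₂1 hc₂f hpair
  exact linearMap_eq_of_det3R_ne_zero hdet h0 h1 h2

end Summit.AtomisticToContinuum.Crystallization.Theorems.OverbindingBudgetAffineFarSmoothSplit
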